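import Mathlib

/-!
# Class `{o, b}` (a₃ adjacent exactly to `o` and `b`): the table masses and the form
(blind cell PercRepro2, night-1 g10; NIGHT1-G10.md §2)

The natural vocabulary of the star-closed graph `G₁ = G − a₃` under `Q₁ = {a₁ ↮ a₂}`:
`Z1 = P(Q₁)`, `AL = P(Q₁, oL)`, `AH = P(Q₁, oH)`, `BL = P(Q₁, bL)`, `BH = P(Q₁, bH)`,
`PLL = P(Q₁, oL, bL)`, `PLH = P(Q₁, oL, bH)`, `PHL = P(Q₁, oH, bL)`, `PHH = P(Q₁, oH, bH)`,
`NN = P(Q₁, o ∉ U, b ∉ U)`, `X0 = termW {a₃}` (`Z1 · X0 = AL·BH + AH·BL`); coins `r` (edge `a₃o`)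
and `s` (edge `a₃b`).  Every mass of `HMFc` is a sum over the four coin outcomes of a star-closed
reading (NIGHT1-G10.md §1, `StarOB.prob_star_tbl`); `hmfcMass` is `HMFc` assembled from them
(`ZMeanProof.HMFc`, with `gap = P(Q, bH) − P(Q, bL)`).
-/

namespace Summit.Ventures.PercRepro2

namespace StarOB

section Ring

variable {R : Type*} [CommRing R]

variable (Z1 AL AH BL BH PLL PLH PHL PHH NN X0 r s : R)

/-- The glued `Q`-mass `P₀(Qg) = Z1 − PLH − PHL`. -/
def qgMass : R := Z1 - PLH - PHL

/-- The glued heavy reading `P₀(Qg ∩ (oH ∪ bH))`. -/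
def gHMass : R := AH + BH - PHL - PLH - PHH

/-- The glued light reading `P₀(Qg ∩ (oL ∪ bL))`. -/
def gLMass : R := AL + BL - PLH - PHL - PLL

/-- `P(Q)`. -/
def zMass : R :=
  (1 - r) * (1 - s) * Z1 + r * (1 - s) * Z1 + (1 - r) * s * Z1 + r * s * qgMass Z1 PLH PHL

/-- `D = P(PD)`. -/
def dMass : R :=
  (1 - r) * (1 - s) * Z1 + r * (1 - s) * (Z1 - AL - AH) + (1 - r) * s * (Z1 - BL - BH) +
    r * s * NN

/-- `D_o = P(PD, o ∈ U)`. -/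
def doMass : R :=
  ((1 - r) * (1 - s) * AL + (1 - r) * s * (AL - PLL - PLH)) +
    ((1 - r) * (1 - s) * AH + (1 - r) * s * (AH - PHL - PHH))

/-- `M₂ = P(PD, bH)`. -/
def m2Mass : R := (1 - r) * (1 - s) * BH + r * (1 - s) * (BH - PLH - PHH)

/-- `P(T)`. -/
def ptMass : R := r * (1 - s) * AH + (1 - r) * s * BH + r * s * gHMass AH BH PLH PHL PHH

/-- `P(T, bH)`. -/
def ptbHMass : R := r * (1 - s) * PHH + (1 - r) * s * BH + r * s * gHMass AH BH PLH PHL PHH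

/-- `P(T, bL)`. -/
def ptbLMass : R := r * (1 - s) * PHL

/-- `P(T, o ∈ U)`. -/
def ptoUMass : R :=
  (1 - r) * s * PLH + (r * (1 - s) * AH + (1 - r) * s * PHH + r * s * gHMass AH BH PLH PHL PHH)

/-- `P(T′)`. -/
def ptpMass : R := r * (1 - s) * AL + (1 - r) * s * BL + r * s * gLMass AL BL PLL PLH PHL

/-- `P(T′, o ∈ U)`. -/
def ptpoUMass : R :=
  (r * (1 - s) * AL + (1 - r) * s * PLL + r * s * gLMass AL BL PLL PLH PHL) + (1 - r) * s * PHL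

/-- `P(Q, oL)`. -/
def qoLMass : R :=
  (1 - r) * (1 - s) * AL + r * (1 - s) * AL + (1 - r) * s * AL + r * s * gLMass AL BL PLL PLH PHL

/-- `P(Q, oH)`. -/
def qoHMass : R :=
  (1 - r) * (1 - s) * AH + r * (1 - s) * AH + (1 - r) * s * AH + r * s * gHMass AH BH PLH PHL PHH

/-- `P(Q, bH)`. -/
def qbHMass : R :=
  (1 - r) * (1 - s) * BH + r * (1 - s) * BH + (1 - r) * s * BH + r * s * gHMass AH BH PLH PHL PHH

/-- `P(Q, bL)`. -/
def qbLMass : R :=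
  (1 - r) * (1 - s) * BL + r * (1 - s) * BL + (1 - r) * s * BL + r * s * gLMass AL BL PLL PLH PHL

/-- `X̂`. -/
def xhatMass : R := (1 - r) * (1 - s) * X0 + (1 - r) * s * (PHL + PLH)

/-- **`HMFc` of the class `{o, b}`** as a polynomial in the coins over the natural table
(`HMFc = 2 P(Q) (D_o W − X̂ D) − gap · marginC`, `W = M₂ + P(T, bH) − P(T, bL)`,
`gap = P(Q, bH) − P(Q, bL)`, `marginC = D_o P(Q) − DEF`,
`DEF = D (P(Q,oL) − P(Q,oH)) + D_o (P(T′) − P(T)) − D (P(T′, oU) − P(T, oU))`). -/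
def hmfcMass : R :=
  2 * zMass Z1 PLH PHL r s *
      (doMass AL AH PLL PLH PHL PHH r s *
          (m2Mass BH PLH PHH r s + ptbHMass AH BH PLH PHL PHH r s - ptbLMass PHL r s) -
        xhatMass PLH PHL X0 r s * dMass Z1 AL AH BL BH NN r s) -
    (qbHMass AH BH PLH PHL PHH r s - qbLMass AL BL PLL PLH PHL r s) *
      (doMass AL AH PLL PLH PHL PHH r s * zMass Z1 PLH PHL r s -
        (dMass Z1 AL AH BL BH NN r s *
            (qoLMass AL BL PLL PLH PHL r s - qoHMass AH BH PLH PHL PHH r s) +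
          doMass AL AH PLL PLH PHL PHH r s *
            (ptpMass AL BL PLL PLH PHL r s - ptMass AH BH PLH PHL PHH r s) -
          dMass Z1 AL AH BL BH NN r s *
            (ptpoUMass AL BL PLL PLH PHL r s - ptoUMass AH BH PLH PHL PHH r s)))

end Ring

end StarOB

end Summit.Ventures.PercRepro2
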